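import Mathlib
import HarnessLib
import Summits.QuantumAdvantage.QuantumAdvantage.Theses.CompactnessLift
import Literature.Computability.QuantumComplexity.BQTime
import Literature.Computability.Complexity.RelativizedTime

/-! Fully-qualified forms of the recommended signatures (paste-ready for `route edit --restate` / `workitem set-signature`). -/

-- CP′ (restated CompactnessPrinciple)
example : Prop := Literature.Computability.Cryptography.BQP ⊆ Literature.Computability.Complexity.BPP → ∃ c : ℕ, Literature.Computability.QuantumComplexity.BQTime (fun n => n ^ 2) ⊆ Literature.Computability.Complexity.BPTime (fun n => n ^ c)

-- Ladder′ (restated LanguageLadder)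
example : Prop := ∀ c : ℕ, ∃ L ∈ Literature.Computability.QuantumComplexity.BQTime (fun n => n ^ 2), L ∉ Literature.Computability.Complexity.BPTime (fun n => n ^ c)

-- OracleDichotomyPos (signature for the informal item stmt-QuantumAdvantage-15277)
example : Prop := ∃ A : Language Bool, Literature.Computability.Cryptography.BQPRel A ⊆ Literature.Computability.Complexity.BPPRel (Literature.Computability.Complexity.Oracle.ofLanguage A) ∧ ∀ c : ℕ, ∃ L ∈ Literature.Computability.QuantumComplexity.BQTimeRel A (fun n => n ^ 2), L ∉ Literature.Computability.Complexity.BPTimeRel (Literature.Computability.Complexity.Oracle.ofLanguage A) (fun n => n ^ c)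

-- PlImpliesCp′ (restated support 15273) and SummitGivesLadder′ (restated support 15274)
example : Prop := (Literature.Computability.Cryptography.BQP ⊆ Literature.Computability.Complexity.BPP → Literature.Computability.Cryptography.PromiseBQP ⊆ Literature.Computability.Complexity.PromiseBPP') → (Literature.Computability.Cryptography.BQP ⊆ Literature.Computability.Complexity.BPP → ∃ c : ℕ, Literature.Computability.QuantumComplexity.BQTime (fun n => n ^ 2) ⊆ Literature.Computability.Complexity.BPTime (fun n => n ^ c))
example : Prop := QuantumAdvantage → ∀ c : ℕ, ∃ L ∈ Literature.Computability.QuantumComplexity.BQTime (fun n => n ^ 2), L ∉ Literature.Computability.Complexity.BPTime (fun n => n ^ c)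

-- the restated route still closes by the same three lines of logic
example (h₁ : Literature.Computability.Cryptography.BQP ⊆ Literature.Computability.Complexity.BPP → ∃ c : ℕ, Literature.Computability.QuantumComplexity.BQTime (fun n => n ^ 2) ⊆ Literature.Computability.Complexity.BPTime (fun n => n ^ c))
    (h₂ : ∀ c : ℕ, ∃ L ∈ Literature.Computability.QuantumComplexity.BQTime (fun n => n ^ 2), L ∉ Literature.Computability.Complexity.BPTime (fun n => n ^ c)) :
    QuantumAdvantage := by
  by_contra hS
  have hsub : Literature.Computability.Cryptography.BQP ⊆ Literature.Computability.Complexity.BPP := by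
    intro L hL
    by_contra hLB
    exact hS ⟨L, hL, hLB⟩
  obtain ⟨c, hc⟩ := h₁ hsub
  obtain ⟨L, hL, hLc⟩ := h₂ c
  exact hLc (hc hL)
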